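import Summits.BirchSwinnertonDyer.Rank1Residual.Iwasawa.LayerOneNorm
import HarnessLib

/-!
# Route `AlignedTransportAtTwo`, crux C2 `MainConjectureOfRankZeroBSDAtTwo` (stmt-BirchSwinnertonDyer-22298):
# THE RELATIVE NORM `N_n = ∑_{j<p} γ^{pⁿ j}` OF THE LAYER `K_{n+1}/K_n` ON `E(K_{n+1})` — its values come from `E(K_n)`, and its kernel
# lattice has rank `≥ rank E(K_{n+1}) − rank E(K_n)` (the arithmetic half of Greenberg's p. 132 argument AT EVERY LAYER)

HONEST FRAMING (cell `bsd-f1-sign2`, WIDTH-5 attached prover seat `bsd-line-att-p5` gen 36 on line `birth` of the lead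
`bsd-line-att-p2`; `--supports` stmt-BirchSwinnertonDyer-22298, closes nothing; BSD is NOT proved by any of this; the crux C2, its
verdict «blocked-on `Rank1Residual.GreenbergMuConjectureIrreducible`» and every registered stub are untouched). Elementary arithmetic of
Mordell–Weil groups in a `ℤ_p`-tower — THEOREMS ONLY (no `def`, no instance, no named fact, no `sorry`; the classical `DecidableEq` on
a layer `K_n` that the tree's `layerGal` / `mordellWeilRank` carry is pinned by a term-level `letI` inside the three statements that add points
of `E(K_{n+1})`, exactly the tree's reducible `decEqLayer`): the relative norm is written out as the
explicit sum `∑ j ∈ range p, γ ^ (pⁿ·j) • ι_{n+1}(P)` in `E(K̄)` everywhere (the tree's `Iwasawa/LayerOneNorm.lean` is the case `n = 0`,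
where it is the definition `layerNormMap`). For an elliptic curve `E/K` over a number field, ANY `ℤ_p`-extension `κ` (layers `K_n`,
`Gal(K̄/K_n) = κ⁻¹(pⁿℤ_p)`) and a topological generator `γ`:

* §1 `Gal(K̄/K_n) = ⋃_m (γ^{pⁿ})^m · Gal(K̄/K_{n+1})` (`exists_eq_pow_pow_mul_of_mem_layerSubgroup`: `σ = γ^m τ` with `pⁿ ∣ m`, read in `ℤ_p`).
* §2 THE RELATIVE NORM `N_n(P) = ∑_{j<p} γ^{pⁿ j} • ι_{n+1}(P)` (`P ∈ E(K_{n+1})`): fixed by `Gal(K̄/K_{n+1})` (normality), by `γ^{pⁿ}`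
  (`γ^{p^{n+1}} ∈ Gal(K̄/K_{n+1})`), hence by `Gal(K̄/K_n)` (§1); so ★ `exists_layerPoints_eq_relNorm` — **`N_n(P) = ι_n(Q)` for a point
  `Q ∈ E(K_n)`** (Galois descent to the layer, tree `exists_layerPointsMap_eq`); and `N_n(P) = ι_{n+1}(∑_{j<p} (γ^{pⁿ})^j · P)` for the
  descended action `layerGal` (`relNorm_eq_layerPointsMap_sum`).
* §3 ★★ `exists_points_functionals_relNorm` — **for every `r` with `rank E(K_n) + r ≤ rank E(K_{n+1})` there are `r` points
  `P_i ∈ E(K_{n+1})` KILLED BY THE RELATIVE NORM (`∑_{j<p} (γ^{pⁿ})^j · P_i = 0` in `E(K_{n+1})`) and functionals `λ_k : E(K_{n+1}) → ℤ` with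
  `λ_k(P_i) = N₀ δ_{ki}`, `N₀ ≠ 0`** (rank–nullity over `ℤ` for `N_n : E(K_{n+1}) → ι_n(E(K_n)) ≅ E(K_n)`, then the tree's
  `exists_points_functionals_of_le` on the kernel lattice). This is the input «`E(K_{n+1}) ⊗ ℚ ⊇ ρ_{n+1}^{t}` with
  `φ(p^{n+1})·t = rank E(K_{n+1}) − rank E(K_n)`» of Greenberg's count at layer `n+1` (`ρ_{n+1} = ℚ(ζ_{p^{n+1}})` the faithful irreducible
  representation of `Gal(K_{n+1}/K)`), in the form consumed by the companion file `…CyclotomicLayerRankGrowth`.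

References: R. Greenberg, LNM 1716 (1999), §1 p. 63, §3 p. 86, §5 p. 132 [GreenbergLNM1716]; L. C. Washington, *Introduction to Cyclotomic
Fields*, §13.1 (layers of a `ℤ_p`-extension) [Washington1997]; J. Silverman, *AEC*, VIII §1 (Galois descent for points) [SilvermanAEC2009].
-/

set_option linter.dupNamespace false
set_option autoImplicit false

noncomputable section

open scoped Classical

namespace Summit.BirchSwinnertonDyer.BirchSwinnertonDyer.Theorems.AlignedTransportAtTwoCyclotomicLayerNorm

open WeierstrassCurve Literature.NumberTheory.EllipticCurves Summit.BirchSwinnertonDyer.Rank1Residual.Iwasawa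

universe u

/-! ## §1 `Gal(K̄/K_n) = ⋃_m (γ^{pⁿ})^m · Gal(K̄/K_{n+1})` -/

section Generation

variable {K : Type u} [Field K] {p : ℕ} [hp : Fact p.Prime] (κ : ZpExtension K p)

/-- **`Gal(K̄/K_n) = ⋃_m (γ^{pⁿ})^m · Gal(K̄/K_{n+1})`**: for a topological generator `γ` (`κ γ = 1`), every `σ ∈ κ⁻¹(pⁿℤ_p)` is
`(γ^{pⁿ})^m · τ` with `τ ∈ κ⁻¹(p^{n+1}ℤ_p)` (`σ = γ^{m'} τ` by the tree's `exists_eq_pow_mul_of_isTopGenerator`, and `pⁿ ∣ m'` since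
`κ σ = m' + κ τ`; `pⁿ ∣ m'` in `ℤ_p` iff in `ℕ`, the tree's `ZpTower.pow_p_dvd_natCast_iff` / Mathlib `PadicInt.pow_p_dvd_int_iff`).
Washington §13.1 (`Gal(K_{n+1}/K_n)` is cyclic of order `p` generated by `γ^{pⁿ}`). [cite: Washington1997, §13.1] -/
theorem exists_eq_pow_pow_mul_of_mem_layerSubgroup {γ : Field.absoluteGaloisGroup K} (hγ : κ.IsTopGenerator γ) (n : ℕ)
    {σ : Field.absoluteGaloisGroup K} (hσ : σ ∈ κ.layerSubgroup n) :
    ∃ (m : ℕ) (τ : Field.absoluteGaloisGroup K), τ ∈ κ.layerSubgroup (n + 1) ∧ σ = (γ ^ p ^ n) ^ m * τ := by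
  obtain ⟨m', τ, hτ, rfl⟩ := exists_eq_pow_mul_of_isTopGenerator κ hγ (n + 1) σ
  have hγ' : κ γ = Multiplicative.ofAdd 1 := hγ
  have hτ' := hτ
  rw [ZpExtension.mem_layerSubgroup] at hσ hτ'
  rw [map_mul, map_pow, hγ', ← ofAdd_nsmul, toAdd_mul, toAdd_ofAdd, nsmul_eq_mul, mul_one] at hσ
  have hdvd : (p : ℤ_[p]) ^ n ∣ (m' : ℤ_[p]) := by
    have h1 : (p : ℤ_[p]) ^ n ∣ (κ τ).toAdd := (pow_dvd_pow _ n.le_succ).trans hτ'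
    simpa using (dvd_sub hσ h1)
  have hdvd' : p ^ n ∣ m' := by
    rw [← Int.natCast_dvd_natCast, Nat.cast_pow, ← PadicInt.pow_p_dvd_int_iff, Int.cast_natCast]
    exact hdvd
  obtain ⟨m, rfl⟩ := hdvd'
  exact ⟨m, τ, hτ, by rw [pow_mul]⟩

end Generation

/-! ## §2 The relative norm `N_n(P) = ∑_{j<p} γ^{pⁿ j} • ι_{n+1}(P)` on `E(K_{n+1})`: Galois invariance and descent to `E(K_n)` -/

section Norm

variable {K : Type u} [Field K] [NumberField K] (W : WeierstrassCurve K) {p : ℕ} [hp : Fact p.Prime]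
  (κ : ZpExtension K p) (γ : Field.absoluteGaloisGroup K) (n : ℕ)

omit [NumberField K] in
/-- `N_n(P) = ι_{n+1}(∑_{j<p} (γ^{pⁿ})^j · P)` with the descended action `layerGal` of `Γ_K` on `E(K_{n+1})` (tree
`layerPointsMap_layerGal_iterate`). [cite: GreenbergLNM1716, §5 p. 132] -/
theorem relNorm_eq_layerPointsMap_sum (P : (W.baseChange (κ.layer (n + 1))).toAffine.Point) :
    letI : DecidableEq (κ.layer (n + 1)) := fun a b ↦ Classical.propDecidable (a = b)
    ∑ j ∈ Finset.range p, γ ^ (p ^ n * j) • layerPointsMap W κ (n + 1) P =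
      layerPointsMap W κ (n + 1) (∑ j ∈ Finset.range p, (layerGal W κ (n + 1) (γ ^ p ^ n))^[j] P) := by
  letI : DecidableEq (κ.layer (n + 1)) := fun a b ↦ Classical.propDecidable (a = b)
  rw [map_sum]
  exact Finset.sum_congr rfl fun j _ ↦ by rw [layerPointsMap_layerGal_iterate, pow_mul]

omit [NumberField K] in
/-- `Gal(K̄/K_{n+1})` fixes `N_n(P)` (each `γ^{pⁿ j} • ι(P)` is fixed, by normality of `κ⁻¹(p^{n+1}ℤ_p)`; tree `smul_smul_layerPointsMap`).
[cite: GreenbergLNM1716, §5 p. 132] -/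
theorem smul_relNorm_of_mem_layerSubgroup_succ {τ : Field.absoluteGaloisGroup K} (hτ : τ ∈ κ.layerSubgroup (n + 1))
    (P : (W.baseChange (κ.layer (n + 1))).toAffine.Point) :
    τ • (∑ j ∈ Finset.range p, γ ^ (p ^ n * j) • layerPointsMap W κ (n + 1) P) =
      ∑ j ∈ Finset.range p, γ ^ (p ^ n * j) • layerPointsMap W κ (n + 1) P := by
  rw [Finset.smul_sum]
  exact Finset.sum_congr rfl fun j _ ↦ smul_smul_layerPointsMap W κ (n + 1) (γ ^ (p ^ n * j)) P τ hτ

omit [NumberField K] in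
/-- Shifting a sum over `range m` by one when `f m = f 0`. [folklore] -/
theorem sum_range_shift {A : Type*} [AddCommMonoid A] (f : ℕ → A) (m : ℕ) (h : f m = f 0) :
    ∑ i ∈ Finset.range m, f (i + 1) = ∑ i ∈ Finset.range m, f i := by
  cases m with
  | zero => simp
  | succ q => rw [Finset.sum_range_succ, Finset.sum_range_succ' f, h]

omit [NumberField K] in
/-- **`γ^{pⁿ}` fixes `N_n(P)`** for a topological generator `γ`: `γ^{pⁿ} • ∑_{j<p} γ^{pⁿ j} ι(P) = ∑_{j<p} γ^{pⁿ(j+1)} ι(P)` and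
`γ^{p^{n+1}} ∈ Gal(K̄/K_{n+1})` fixes `ι(P)` (tree `pow_mem_layerSubgroup`). [cite: GreenbergLNM1716, §5 p. 132] [cite: Washington1997, §13.1] -/
theorem pow_smul_relNorm {γ : Field.absoluteGaloisGroup K} (hγ : κ.IsTopGenerator γ)
    (P : (W.baseChange (κ.layer (n + 1))).toAffine.Point) :
    γ ^ p ^ n • (∑ j ∈ Finset.range p, γ ^ (p ^ n * j) • layerPointsMap W κ (n + 1) P) =
      ∑ j ∈ Finset.range p, γ ^ (p ^ n * j) • layerPointsMap W κ (n + 1) P := by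
  rw [Finset.smul_sum]
  simp_rw [smul_smul, ← pow_add]
  have e : ∀ j : ℕ, p ^ n + p ^ n * j = p ^ n * (j + 1) := fun j ↦ by ring
  simp_rw [e]
  refine sum_range_shift (fun j ↦ γ ^ (p ^ n * j) • layerPointsMap W κ (n + 1) P) p ?_
  rw [mul_zero, pow_zero, one_smul, ← pow_succ]
  exact smul_layerPointsMap W κ (n + 1) P _ (ZpExtension.pow_mem_layerSubgroup κ hγ (n + 1))

omit [NumberField K] in
/-- **`Gal(K̄/K_n)` fixes `N_n(P)`** (§1: `Gal(K̄/K_n)` is generated by `γ^{pⁿ}` and `Gal(K̄/K_{n+1})`).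
[cite: GreenbergLNM1716, §5 p. 132] [cite: Washington1997, §13.1] -/
theorem smul_relNorm_of_mem_layerSubgroup {γ : Field.absoluteGaloisGroup K} (hγ : κ.IsTopGenerator γ)
    {σ : Field.absoluteGaloisGroup K} (hσ : σ ∈ κ.layerSubgroup n)
    (P : (W.baseChange (κ.layer (n + 1))).toAffine.Point) :
    σ • (∑ j ∈ Finset.range p, γ ^ (p ^ n * j) • layerPointsMap W κ (n + 1) P) =
      ∑ j ∈ Finset.range p, γ ^ (p ^ n * j) • layerPointsMap W κ (n + 1) P := by
  have hpow : ∀ m : ℕ, (γ ^ p ^ n) ^ m • (∑ j ∈ Finset.range p, γ ^ (p ^ n * j) • layerPointsMap W κ (n + 1) P) =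
      ∑ j ∈ Finset.range p, γ ^ (p ^ n * j) • layerPointsMap W κ (n + 1) P := fun m ↦ by
    induction m with
    | zero => rw [pow_zero, one_smul]
    | succ m ih => rw [pow_succ, mul_smul, pow_smul_relNorm W κ n hγ P, ih]
  obtain ⟨m, τ, hτ, rfl⟩ := exists_eq_pow_pow_mul_of_mem_layerSubgroup κ hγ n hσ
  rw [mul_smul, smul_relNorm_of_mem_layerSubgroup_succ W κ γ n hτ P, hpow]

omit [NumberField K] in
/-- ★ **`N_n(P) ∈ ι_n(E(K_n))`**: for a topological generator `γ`, the relative norm of a point of `E(K_{n+1})` is fixed by `Gal(K̄/K_n)`,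
hence is the image of a `K_n`-rational point (Galois descent to the layer, tree `exists_layerPointsMap_eq`). For `n = 0` this is the
tree's `layerNormMap_mem_range` (`N_γ(P) ∈ E(K)`). [cite: GreenbergLNM1716, §5 p. 132] [cite: SilvermanAEC2009, VIII.§1] -/
theorem exists_layerPoints_eq_relNorm {γ : Field.absoluteGaloisGroup K} (hγ : κ.IsTopGenerator γ)
    (P : (W.baseChange (κ.layer (n + 1))).toAffine.Point) :
    ∃ Q : (W.baseChange (κ.layer n)).toAffine.Point,
      layerPointsMap W κ n Q = ∑ j ∈ Finset.range p, γ ^ (p ^ n * j) • layerPointsMap W κ (n + 1) P :=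
  exists_layerPointsMap_eq W κ n _ fun _ hσ ↦ smul_relNorm_of_mem_layerSubgroup W κ n hγ hσ P

omit [NumberField K] in
/-- If `N_n(P) = 0` in `E(K̄)` then `∑_{j<p} (γ^{pⁿ})^j · P = 0` in `E(K_{n+1})` (injectivity of `ι_{n+1}`). [cite: GreenbergLNM1716, §5 p. 132] -/
theorem sum_layerGal_iterate_eq_zero_of_relNorm_eq_zero {P : (W.baseChange (κ.layer (n + 1))).toAffine.Point}
    (hP : ∑ j ∈ Finset.range p, γ ^ (p ^ n * j) • layerPointsMap W κ (n + 1) P = 0) :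
    letI : DecidableEq (κ.layer (n + 1)) := fun a b ↦ Classical.propDecidable (a = b)
    ∑ j ∈ Finset.range p, (layerGal W κ (n + 1) (γ ^ p ^ n))^[j] P = 0 := by
  letI : DecidableEq (κ.layer (n + 1)) := fun a b ↦ Classical.propDecidable (a = b)
  apply layerPointsMap_injective W κ (n + 1)
  rw [← relNorm_eq_layerPointsMap_sum, map_zero, hP]

/-! ## §3 Points killed by the relative norm, with dual functionals: `r = rank E(K_{n+1}) − rank E(K_n)` of them -/

variable [W.IsElliptic]

/-- ★★ **`rank E(K_{n+1}) − rank E(K_n)` INDEPENDENT POINTS KILLED BY THE RELATIVE NORM, WITH DUAL FUNCTIONALS.** For `E/K` elliptic over a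
number field, a `ℤ_p`-extension `κ` with topological generator `γ`, and `r` with `rank_ℤ E(K_n) + r ≤ rank_ℤ E(K_{n+1})`: there are points
`P_0, …, P_{r−1} ∈ E(K_{n+1})` with **`∑_{j<p} (γ^{pⁿ})^j · P_i = 0`** and `ℤ`-linear functionals `λ_k : E(K_{n+1}) → ℤ` (`k < r`) with
`λ_k(P_i) = N₀ δ_{ki}`, `N₀ ≠ 0`. PROOF: the relative norm `N_n : E(K_{n+1}) → E(K̄)` is additive with image inside `ι_n(E(K_n))`
(`exists_layerPoints_eq_relNorm`), of `ℤ`-rank `≤ rank E(K_n)`; by rank–nullity (Mordell–Weil over the number field `K_{n+1}`) its kernel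
lattice `A_n` has `rank_ℤ A_n ≥ rank E(K_{n+1}) − rank E(K_n) ≥ r`; the tree's `exists_points_functionals_of_le` supplies independent points of
`A_n` with dual functionals on all of `E(K_{n+1})`. On `A_n` the cyclic group `Gal(K_{n+1}/K_n) = ⟨γ^{pⁿ}⟩` acts with norm zero, i.e.
`A_n ⊗ ℚ` is a multiple of the faithful representation `ρ_{n+1}` of `Gal(K_{n+1}/K)` (Greenberg: «isomorphic to `ρ^t`»). The case `n = 0`
is the tree's `mordellWeilRank_layer_one_le` + `exists_points_functionals_of_le (rhoLattice W κ γ)`. [cite: GreenbergLNM1716, §5 p. 132] -/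
theorem exists_points_functionals_relNorm {γ : Field.absoluteGaloisGroup K} (hγ : κ.IsTopGenerator γ) {r : ℕ}
    (hr : (W.baseChange (κ.layer n)).mordellWeilRank + r ≤ (W.baseChange (κ.layer (n + 1))).mordellWeilRank) :
    letI : DecidableEq (κ.layer (n + 1)) := fun a b ↦ Classical.propDecidable (a = b)
    ∃ (P : Fin r → (W.baseChange (κ.layer (n + 1))).toAffine.Point)
      (lam : Fin r → ((W.baseChange (κ.layer (n + 1))).toAffine.Point →ₗ[ℤ] ℤ)) (N₀ : ℕ), N₀ ≠ 0 ∧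
      (∀ i, ∑ j ∈ Finset.range p, (layerGal W κ (n + 1) (γ ^ p ^ n))^[j] (P i) = 0) ∧
      ∀ k i, lam k (P i) = if k = i then (N₀ : ℤ) else 0 := by
  -- ONE classical `DecidableEq` for EVERY layer (a single local instance: two separate ones would make instance resolution
  -- try `K_n` against `K_{n+1}` and unfold `ZpExtension.layer`)
  letI : ∀ m, DecidableEq (κ.layer m) := fun m a b ↦ Classical.propDecidable (a = b)
  haveI : FiniteDimensional K (κ.layer (n + 1)) := κ.finiteDimensional_layer_holds (n + 1)
  haveI : NumberField (κ.layer (n + 1)) := NumberField.of_module_finite K (κ.layer (n + 1))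
  haveI : FiniteDimensional K (κ.layer n) := κ.finiteDimensional_layer_holds n
  haveI : NumberField (κ.layer n) := NumberField.of_module_finite K (κ.layer n)
  -- Mordell–Weil for `E(K_{n+1})`, `E(K_n)` (instances taken verbatim from the tree, no re-synthesis of the group law on points)
  haveI := (W.baseChange (κ.layer (n + 1))).module_finite_point_holds
  haveI := (W.baseChange (κ.layer n)).module_finite_point_holds
  -- the relative norm as an additive map `E(K_{n+1}) → E(K̄)`, composed from tree homomorphisms
  let Nend : geomPoints W →+ geomPoints W :=
    { toFun := fun Q ↦ ∑ j ∈ Finset.range p, γ ^ (p ^ n * j) • Q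
      map_zero' := by simp
      map_add' := fun Q Q' ↦ by simp [Finset.sum_add_distrib] }
  let N := Nend.comp (layerPointsMap W κ (n + 1))
  have hN : ∀ P, N P = ∑ j ∈ Finset.range p, γ ^ (p ^ n * j) • layerPointsMap W κ (n + 1) P := fun _ ↦ rfl
  set φ := N.toIntLinearMap with hφ
  -- rank–nullity: `rank E(K_{n+1}) = rank (range φ) + rank (ker φ)`, `rank (range φ) ≤ rank E(K_n)`
  have h1 := Submodule.finrank_quotient_add_finrank (LinearMap.ker φ)
  rw [φ.quotKerEquivRange.finrank_eq] at h1
  have h2 : Module.finrank ℤ (LinearMap.range φ) ≤ (W.baseChange (κ.layer n)).mordellWeilRank := by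
    have hle : LinearMap.range φ ≤ LinearMap.range (layerPointsMap W κ n).toIntLinearMap := by
      rintro _ ⟨P, rfl⟩
      obtain ⟨Q, hQ⟩ := exists_layerPoints_eq_relNorm W κ n hγ P
      exact ⟨Q, hQ.trans (hN P).symm⟩
    unfold WeierstrassCurve.mordellWeilRank
    rw [← LinearMap.finrank_range_of_inj (f := (layerPointsMap W κ n).toIntLinearMap) (layerPointsMap_injective W κ n)]
    exact Submodule.finrank_mono hle
  have hA : r ≤ Module.finrank ℤ (LinearMap.ker φ) := by
    unfold WeierstrassCurve.mordellWeilRank at h2 hr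
    change Module.finrank ℤ _ + Module.finrank ℤ (LinearMap.ker φ) = Module.finrank ℤ _ at h1
    omega
  -- independent points of the kernel lattice with dual functionals
  obtain ⟨P, lam, N₀, hN₀, hPA, hlam⟩ := exists_points_functionals_of_le (LinearMap.ker φ)
  refine ⟨fun i ↦ P (Fin.castLE hA i), fun k ↦ lam (Fin.castLE hA k), N₀, hN₀, fun i ↦ ?_, fun k i ↦ ?_⟩
  · apply sum_layerGal_iterate_eq_zero_of_relNorm_eq_zero W κ γ n
    rw [← hN]
    exact LinearMap.mem_ker.mp (hPA _)
  · rw [hlam]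
    simp only [Fin.castLE_inj]

end Norm

end Summit.BirchSwinnertonDyer.BirchSwinnertonDyer.Theorems.AlignedTransportAtTwoCyclotomicLayerNorm
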